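import Summits.NavierStokesRegularity.NavierStokesRegularity.Theses.RellichScar
import Summits.NavierStokesRegularity.NavierStokesRegularity.Theorems.ScarRigidity.Negative.LogicAndLoadBearing
import Summits.NavierStokesRegularity.NavierStokesRegularity.Theorems.RellichScarDefs
import Summits.NavierStokesRegularity.NavierStokesRegularity.Theorems.RellichScarScarRigidityFarFieldAllOrders
import Summits.NavierStokesRegularity.NavierStokesRegularity.Theorems.RellichScarScarRigidityApexRegularityExchange
import Literature.Analysis.FluidPDE.TypeIAncientMild
import HarnessLib

/-!
# `ScarRigidity` — line `SketchIdeator6` (generator–hull), stub `stub_dilationGeneratorFlat` (S2a)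
# (crux stmt-NavierStokesRegularity-11717, route RellichScar)

**S2a — a homogeneous scar makes the spatial dilation generator flat.**  Let `V` be a smooth apex profile on
the open backward slab `(-∞,0) × ℝ³` (Type-I ancient mild, apex bound `‖V(t,x)‖ ≤ C/(‖x‖+√(−t))`, classical on
`(−∞,0)` with the scale-invariant package `ScaleInvariantBounds V Q`) all of whose parabolic rescalings
`V_λ(t,x) = λV(λ²t,λx)` have the SAME SCAR as `V`.  Then the spatial dilation generator
`g(t,x) = V(t,x) + ∇V(t,x)·x = (d/dμ)|_{μ=1} μV(t,μx)` obeys the scale-invariant weighted bound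
`‖g(t,x)‖ ≤ K(−t)/(‖x‖+√(−t))³` on the whole slab.

Proof (elementary).
1. *Final profile.*  The package gives `‖∂ₜV‖ ≤ L₀/‖x‖³`, `‖∂ₜ∇V‖ ≤ L₁/‖x‖⁴`, so the time lines `s ↦ V(s,x)`,
   `s ↦ ∇V(s,x)` are Lipschitz near `s = 0`, locally uniformly in `x ≠ 0`; hence `V(s,·) → U`, `∇V(s,·) → U'`
   pointwise off the origin (completeness), locally uniformly for `∇V`, and `U` is differentiable off the origin
   with `DU = U'` (limits of derivatives, Mathlib `hasFDerivAt_of_tendstoUniformlyOnFilter`).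
2. *Homogeneity.*  The scar hypothesis read on the continuous representatives (`tendsto_sub_of_sameScar`) says
   `λV(λ²s,λx) − V(s,x) → 0` as `s ↑ 0`; with step 1, `λU(λx) = U(x)` for `λ > 0`, `x ≠ 0`.  Euler's identity:
   differentiating `μ ↦ μU(μx) ≡ U(x)` at `μ = 1` gives `U(x) + U'(x)x = 0`, so `g(s,x) → 0` as `s ↑ 0`.
3. *Mean value inequality in time* (pattern of `stub_farFieldOfScar`): `‖∂ₜg(t,x)‖ ≤ ‖∂ₜV‖ + ‖∂ₜ∇V‖‖x‖ ≤
   (L₀+L₁)/‖x‖³`, so `‖g(t,x)‖ ≤ (L₀+L₁)(−t)/‖x‖³` for `x ≠ 0`.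
4. *Weighted form.*  On `√(−t) ≤ ‖x‖`, `(−t)/‖x‖³ ≤ 8(−t)/(‖x‖+√(−t))³`; on the core `‖x‖ < √(−t)` the apex bound
   and `‖∇V‖ ≤ L₁/(‖x‖+√(−t))²` give `‖g‖ ≤ (C+L₁)/√(−t) ≤ 8(C+L₁)(−t)/(‖x‖+√(−t))³`.
-/

noncomputable section

open Set Filter Function MeasureTheory Metric TopologicalSpace
open scoped Topology ENNReal NNReal InnerProductSpace RealInnerProductSpace ContDiff
open Literature.Analysis.FluidPDE
open Summit.NavierStokesRegularity.NavierStokesRegularity.Theses.RellichScar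
open Summit.NavierStokesRegularity.NavierStokesRegularity.Theorems.ScarRigidity.Negative

set_option linter.dupNamespace false -- D-0017: `Summit.<S>.<S>.…` repeats the summit name by design

namespace Summit.NavierStokesRegularity.NavierStokesRegularity.Theorems.RellichScarScarRigidity

/-- Physical space. -/
local notation "ℝ³" => EuclideanSpace ℝ (Fin 3)

/-! ## The parabolic rescaling of a jointly smooth field -/

/-- The parabolic rescaling `λV(λ²t, λx)`, `λ > 0`, of a field jointly smooth on the open backward slab is
jointly smooth there (composition with the linear map `(t,x) ↦ (λ²t, λx)`, which preserves the slab). [folklore] -/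
theorem isSmoothSpaceTimeOn_nsRescale {V : ℝ → ℝ³ → ℝ³} (hV : IsSmoothSpaceTimeOn (Iio (0 : ℝ)) V)
    {lam : ℝ} (hlam : 0 < lam) : IsSmoothSpaceTimeOn (Iio (0 : ℝ)) (nsRescale lam V) := by
  unfold IsSmoothSpaceTimeOn at hV ⊢
  have hΦ : ContDiff ℝ ∞ fun z : ℝ × ℝ³ => ((lam ^ 2 * z.1, lam • z.2) : ℝ × ℝ³) :=
    (contDiff_const.mul contDiff_fst).prodMk (contDiff_snd.const_smul lam)
  have hmaps : MapsTo (fun z : ℝ × ℝ³ => ((lam ^ 2 * z.1, lam • z.2) : ℝ × ℝ³))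
      (Iio (0 : ℝ) ×ˢ (univ : Set ℝ³)) (Iio (0 : ℝ) ×ˢ (univ : Set ℝ³)) := fun z hz =>
    ⟨show lam ^ 2 * z.1 < 0 from mul_neg_of_pos_of_neg (pow_pos hlam 2) hz.1, mem_univ _⟩
  have h1 : ContDiffOn ℝ ∞
      (fun z => lam • (uncurry V ∘ fun z : ℝ × ℝ³ => ((lam ^ 2 * z.1, lam • z.2) : ℝ × ℝ³)) z)
      (Iio (0 : ℝ) ×ˢ (univ : Set ℝ³)) :=
    (ContDiffOn.comp hV hΦ.contDiffOn hmaps).const_smul lam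
  refine h1.congr ?_
  rintro ⟨s, y⟩ -
  simp [nsRescale_apply]

/-! ## Time-Lipschitz bounds and the final profile -/

/-- **Mean value inequality in time, order zero**: `‖∂ₜV(t,x)‖ ≤ L₀/(‖x‖+√(−t))³ ≤ L₀/ρ³` on `ρ ≤ ‖x‖` gives
`‖V(t,x) − V(s,x)‖ ≤ L₀|t−s|/ρ³` for `s, t < 0`. [folklore] -/
theorem norm_apexSlice_sub_le {V : ℝ → ℝ³ → ℝ³} (hV : IsSmoothSpaceTimeOn (Iio (0 : ℝ)) V)
    {L₀ ρ : ℝ} (hL₀ : 0 ≤ L₀) (hρ : 0 < ρ)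
    (hT0 : ∀ t < 0, ∀ x : ℝ³, ‖deriv (fun s => V s x) t‖ ≤ L₀ / (‖x‖ + Real.sqrt (-t)) ^ 3)
    {x : ℝ³} (hx : ρ ≤ ‖x‖) {s t : ℝ} (hs : s < 0) (ht : t < 0) :
    ‖V t x - V s x‖ ≤ L₀ / ρ ^ 3 * |t - s| := by
  have hderiv : ∀ τ ∈ Iio (0 : ℝ), HasDerivWithinAt (fun σ => V σ x) (deriv (fun σ => V σ x) τ) (Iio 0) τ :=
    fun τ hτ => (hV.hasDerivAt_timeLine isOpen_Iio hτ x).hasDerivWithinAt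
  have hbound : ∀ τ ∈ Iio (0 : ℝ), ‖deriv (fun σ => V σ x) τ‖ ≤ L₀ / ρ ^ 3 := by
    intro τ hτ
    have hpow : ρ ^ 3 ≤ (‖x‖ + Real.sqrt (-τ)) ^ 3 :=
      pow_le_pow_left₀ hρ.le (hx.trans (le_add_of_nonneg_right (Real.sqrt_nonneg _))) 3
    exact (hT0 τ hτ x).trans (div_le_div_of_nonneg_left hL₀ (pow_pos hρ 3) hpow)
  have h := (convex_Iio (0 : ℝ)).norm_image_sub_le_of_norm_hasDerivWithin_le hderiv hbound hs ht
  rwa [Real.norm_eq_abs] at h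

/-- **Mean value inequality in time, order one**: `‖∇∂ₜV(t,x)‖ ≤ L₁/(‖x‖+√(−t))⁴ ≤ L₁/ρ⁴` on `ρ ≤ ‖x‖` gives
`‖∇V(t,x) − ∇V(s,x)‖ ≤ L₁|t−s|/ρ⁴` for `s, t < 0` (exchange `∂ₜ∇ = ∇∂ₜ` for jointly smooth fields,
`hasDerivAt_fderiv_slice_clm`). [folklore] -/
theorem norm_fderiv_apexSlice_sub_le {V : ℝ → ℝ³ → ℝ³} (hV : IsSmoothSpaceTimeOn (Iio (0 : ℝ)) V)
    {L₁ ρ : ℝ} (hL₁ : 0 ≤ L₁) (hρ : 0 < ρ)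
    (hT1 : ∀ t < 0, ∀ x : ℝ³,
      ‖fderiv ℝ (fun y => deriv (fun s => V s y) t) x‖ ≤ L₁ / (‖x‖ + Real.sqrt (-t)) ^ 4)
    {x : ℝ³} (hx : ρ ≤ ‖x‖) {s t : ℝ} (hs : s < 0) (ht : t < 0) :
    ‖fderiv ℝ (V t) x - fderiv ℝ (V s) x‖ ≤ L₁ / ρ ^ 4 * |t - s| := by
  have hderiv : ∀ τ ∈ Iio (0 : ℝ), HasDerivWithinAt (fun σ => fderiv ℝ (V σ) x)
      (fderiv ℝ (fun y => deriv (fun σ => V σ y) τ) x) (Iio 0) τ :=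
    fun τ hτ => (hV.hasDerivAt_fderiv_slice_clm isOpen_Iio hτ x).hasDerivWithinAt
  have hbound : ∀ τ ∈ Iio (0 : ℝ), ‖fderiv ℝ (fun y => deriv (fun σ => V σ y) τ) x‖ ≤ L₁ / ρ ^ 4 := by
    intro τ hτ
    have hpow : ρ ^ 4 ≤ (‖x‖ + Real.sqrt (-τ)) ^ 4 :=
      pow_le_pow_left₀ hρ.le (hx.trans (le_add_of_nonneg_right (Real.sqrt_nonneg _))) 4
    exact (hT1 τ hτ x).trans (div_le_div_of_nonneg_left hL₁ (pow_pos hρ 4) hpow)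
  have h := (convex_Iio (0 : ℝ)).norm_image_sub_le_of_norm_hasDerivWithin_le hderiv hbound hs ht
  rwa [Real.norm_eq_abs] at h

/-- A time line with values in a complete group which is Lipschitz on `s < 0` converges as `s ↑ 0`. [folklore] -/
theorem exists_tendsto_nhdsLT_of_lipschitz {G : Type*} [NormedAddCommGroup G] [CompleteSpace G]
    {F : ℝ → G} {M : ℝ} (hM : 0 ≤ M) (h : ∀ s < (0 : ℝ), ∀ t < (0 : ℝ), ‖F t - F s‖ ≤ M * |t - s|) :
    ∃ g : G, Tendsto F (𝓝[<] (0 : ℝ)) (𝓝 g) := by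
  have hC : UniformCauchySeqOn (fun s (_ : Unit) => F s) (𝓝[<] (0 : ℝ)) univ :=
    uniformCauchySeqOn_nhdsLT_of_lipschitz hM fun _ _ s hs t ht => h s hs t ht
  exact cauchy_map_iff_exists_tendsto.1 (hC.cauchy_map (mem_univ ()))

/-- **The final profile and its derivative.**  Under the time-Lipschitz bounds of orders `0` and `1`, the slices
`V(s,·)` converge pointwise off the origin as `s ↑ 0` to a profile `U`, the slice derivatives `∇V(s,·)` converge
to `U'`, and `U` is differentiable off the origin with `DU = U'` (limits of derivatives, locally uniform
convergence of the derivatives). [folklore] -/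
theorem exists_finalProfile {V : ℝ → ℝ³ → ℝ³} (hV : IsSmoothSpaceTimeOn (Iio (0 : ℝ)) V)
    {L₀ L₁ : ℝ} (hL₀ : 0 ≤ L₀) (hL₁ : 0 ≤ L₁)
    (hT0 : ∀ t < 0, ∀ x : ℝ³, ‖deriv (fun s => V s x) t‖ ≤ L₀ / (‖x‖ + Real.sqrt (-t)) ^ 3)
    (hT1 : ∀ t < 0, ∀ x : ℝ³,
      ‖fderiv ℝ (fun y => deriv (fun s => V s y) t) x‖ ≤ L₁ / (‖x‖ + Real.sqrt (-t)) ^ 4) :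
    ∃ (U : ℝ³ → ℝ³) (U' : ℝ³ → ℝ³ →L[ℝ] ℝ³), ∀ x : ℝ³, x ≠ 0 →
      Tendsto (fun s => V s x) (𝓝[<] (0 : ℝ)) (𝓝 (U x)) ∧
        Tendsto (fun s => fderiv ℝ (V s) x) (𝓝[<] (0 : ℝ)) (𝓝 (U' x)) ∧ HasFDerivAt U (U' x) x := by
  -- pointwise limits off the origin
  have hlim0 : ∀ x : ℝ³, x ≠ 0 → ∃ v : ℝ³, Tendsto (fun s => V s x) (𝓝[<] (0 : ℝ)) (𝓝 v) := by
    intro x hx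
    have hxpos : 0 < ‖x‖ := norm_pos_iff.2 hx
    exact exists_tendsto_nhdsLT_of_lipschitz (div_nonneg hL₀ (pow_nonneg hxpos.le 3))
      fun s hs t ht => norm_apexSlice_sub_le hV hL₀ hxpos hT0 le_rfl hs ht
  have hlim1 : ∀ x : ℝ³, x ≠ 0 →
      ∃ A : ℝ³ →L[ℝ] ℝ³, Tendsto (fun s => fderiv ℝ (V s) x) (𝓝[<] (0 : ℝ)) (𝓝 A) := by
    intro x hx
    have hxpos : 0 < ‖x‖ := norm_pos_iff.2 hx
    exact exists_tendsto_nhdsLT_of_lipschitz (div_nonneg hL₁ (pow_nonneg hxpos.le 4))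
      fun s hs t ht => norm_fderiv_apexSlice_sub_le hV hL₁ hxpos hT1 le_rfl hs ht
  choose! U hU using hlim0
  choose! U' hU' using hlim1
  refine ⟨U, U', fun x hx => ⟨hU x hx, hU' x hx, ?_⟩⟩
  -- a ball around `x` avoiding the origin
  have hxpos : 0 < ‖x‖ := norm_pos_iff.2 hx
  obtain ⟨r, hr⟩ : ∃ r : ℝ, r = ‖x‖ / 2 := ⟨_, rfl⟩
  have hr0 : 0 < r := by rw [hr]; exact half_pos hxpos
  have hball : ∀ y ∈ ball x r, r ≤ ‖y‖ := by
    intro y hy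
    rw [mem_ball, dist_eq_norm, norm_sub_rev] at hy
    have h1 : ‖x‖ - ‖y‖ ≤ ‖x - y‖ := norm_sub_norm_le x y
    rw [hr] at hy ⊢
    linarith
  have hball0 : ∀ y ∈ ball x r, y ≠ 0 := fun y hy h0 => by
    linarith [show r ≤ ‖y‖ from hball y hy, show ‖y‖ = 0 by rw [h0, norm_zero]]
  have hIio : ∀ᶠ s in 𝓝[<] (0 : ℝ), s < 0 := self_mem_nhdsWithin
  -- the derivatives converge locally uniformly
  have hC : UniformCauchySeqOn (fun s y => fderiv ℝ (V s) y) (𝓝[<] (0 : ℝ)) (ball x r) :=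
    uniformCauchySeqOn_nhdsLT_of_lipschitz (F := fun s y => fderiv ℝ (V s) y) (U := ball x r)
      (M := L₁ / r ^ 4) (div_nonneg hL₁ (pow_nonneg hr0.le 4))
      fun y hy s hs t ht => norm_fderiv_apexSlice_sub_le hV hL₁ hr0 hT1 (hball y hy) hs ht
  have hunif : TendstoUniformlyOn (fun s y => fderiv ℝ (V s) y) U' (𝓝[<] (0 : ℝ)) (ball x r) :=
    hC.tendstoUniformlyOn_of_tendsto fun y hy => hU' y (hball0 y hy)
  have hf' : TendstoUniformlyOnFilter (fun s y => fderiv ℝ (V s) y) U' (𝓝[<] (0 : ℝ)) (𝓝 x) :=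
    (tendstoUniformlyOn_iff_tendstoUniformlyOnFilter.1 hunif).mono_right
      (le_principal_iff.2 (ball_mem_nhds x hr0))
  have hdf : ∀ᶠ p : ℝ × ℝ³ in 𝓝[<] (0 : ℝ) ×ˢ 𝓝 x, HasFDerivAt (V p.1) (fderiv ℝ (V p.1) p.2) p.2 := by
    filter_upwards [hIio.prod_inl (𝓝 x)] with p hp
    exact (((hV.contDiff_slice (t := p.1) hp).differentiable (by simp)) p.2).hasFDerivAt
  have hfg : ∀ᶠ y in 𝓝 x, Tendsto (fun s => V s y) (𝓝[<] (0 : ℝ)) (𝓝 (U y)) := by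
    filter_upwards [ball_mem_nhds x hr0] with y hy using hU y (hball0 y hy)
  exact hasFDerivAt_of_tendstoUniformlyOnFilter (f := V) (g := U) (f' := fun s y => fderiv ℝ (V s) y) (g' := U')
    hf' hdf hfg

/-! ## Homogeneity of the final profile and the zero scar of the generator -/

/-- **Zero scar of the dilation generator.**  If moreover every rescaling `λV(λ²·,λ·)` has the same final-time
trace as `V` off the origin (pointwise form), then the final profile is `(−1)`-homogeneous, Euler's identity
`U(x) + U'(x)x = 0` holds off the origin, and the spatial dilation generator `V(s,x) + ∇V(s,x)x` tends to `0` as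
`s ↑ 0` for every `x ≠ 0`. [folklore] -/
theorem tendsto_dilationGenerator_zero {V : ℝ → ℝ³ → ℝ³} (hV : IsSmoothSpaceTimeOn (Iio (0 : ℝ)) V)
    {L₀ L₁ : ℝ} (hL₀ : 0 ≤ L₀) (hL₁ : 0 ≤ L₁)
    (hT0 : ∀ t < 0, ∀ x : ℝ³, ‖deriv (fun s => V s x) t‖ ≤ L₀ / (‖x‖ + Real.sqrt (-t)) ^ 3)
    (hT1 : ∀ t < 0, ∀ x : ℝ³,
      ‖fderiv ℝ (fun y => deriv (fun s => V s y) t) x‖ ≤ L₁ / (‖x‖ + Real.sqrt (-t)) ^ 4)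
    (hscal : ∀ lam : ℝ, 0 < lam → ∀ x : ℝ³, x ≠ 0 →
      Tendsto (fun s => nsRescale lam V s x - V s x) (𝓝[<] (0 : ℝ)) (𝓝 0))
    {x : ℝ³} (hx : x ≠ 0) :
    Tendsto (fun s => V s x + fderiv ℝ (V s) x x) (𝓝[<] (0 : ℝ)) (𝓝 0) := by
  obtain ⟨U, U', hUU⟩ := exists_finalProfile hV hL₀ hL₁ hT0 hT1
  -- homogeneity of the final profile: `λ U(λ y) = U y` for `λ > 0`, `y ≠ 0`
  have hhomU : ∀ lam : ℝ, 0 < lam → ∀ y : ℝ³, y ≠ 0 → lam • U (lam • y) = U y := by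
    intro lam hlam y hy
    have hly : lam • y ≠ 0 := smul_ne_zero hlam.ne' hy
    -- the rescaled time `λ² s ↑ 0`
    have htime : Tendsto (fun s : ℝ => lam ^ 2 * s) (𝓝[<] (0 : ℝ)) (𝓝[<] (0 : ℝ)) := by
      refine tendsto_nhdsWithin_iff.2 ⟨?_, ?_⟩
      · have hc : Tendsto (fun s : ℝ => lam ^ 2 * s) (𝓝 (0 : ℝ)) (𝓝 (lam ^ 2 * 0)) :=
          (continuous_const.mul continuous_id).tendsto 0
        rw [mul_zero] at hc
        exact hc.mono_left nhdsWithin_le_nhds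
      · filter_upwards [self_mem_nhdsWithin] with s hs
        exact mul_neg_of_pos_of_neg (pow_pos hlam 2) hs
    have h1 : Tendsto (fun s => nsRescale lam V s y) (𝓝[<] (0 : ℝ)) (𝓝 (lam • U (lam • y))) := by
      have h := ((hUU (lam • y) hly).1.comp htime).const_smul lam
      refine h.congr fun s => ?_
      simp [nsRescale_apply]
    have h2 := h1.sub (hUU y hy).1
    have h3 := tendsto_nhds_unique h2 (hscal lam hlam y hy)
    exact sub_eq_zero.1 h3
  -- Euler's identity at `x`
  obtain ⟨hUx, hU'x, hUd⟩ := hUU x hx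
  have hline : HasDerivAt (fun μ : ℝ => μ • x) x 1 := by
    simpa using (hasDerivAt_id (1 : ℝ)).smul_const x
  have hUd' : HasFDerivAt U (U' x) ((fun μ : ℝ => μ • x) 1) := by
    simpa using hUd
  have hcomp : HasDerivAt (fun μ : ℝ => U (μ • x)) (U' x x) 1 := hUd'.comp_hasDerivAt (1 : ℝ) hline
  have hprod : HasDerivAt (fun μ : ℝ => μ • U (μ • x)) ((1 : ℝ) • U' x x + (1 : ℝ) • U ((1 : ℝ) • x)) 1 :=
    (hasDerivAt_id (1 : ℝ)).smul hcomp
  have hconst : HasDerivAt (fun μ : ℝ => μ • U (μ • x)) 0 1 := by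
    refine (hasDerivAt_const (1 : ℝ) (U x)).congr_of_eventuallyEq ?_
    filter_upwards [Ioi_mem_nhds (zero_lt_one' ℝ)] with μ hμ
    exact hhomU μ hμ x hx
  have hEuler : U x + U' x x = 0 := by
    have h := hprod.unique hconst
    simp only [one_smul] at h
    rwa [add_comm] at h
  -- conclusion
  have happ : Tendsto (fun s => fderiv ℝ (V s) x x) (𝓝[<] (0 : ℝ)) (𝓝 (U' x x)) := by
    have h := ((ContinuousLinearMap.apply ℝ ℝ³ x).continuous.tendsto (U' x)).comp hU'x
    simpa [Function.comp_def] using h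
  have h := hUx.add happ
  rwa [hEuler] at h

/-! ## The stub -/

/-- **STUB S2a — a homogeneous scar makes the dilation generator flat.**  If every rescaling of the smooth
apex profile `V` has the same scar, the spatial dilation generator `V + x·∇V` obeys the scale-invariant weighted
bound `‖V(t,x) + ∇V(t,x)·x‖ ≤ K(−t)/(‖x‖+√(−t))³` on the whole slab (zero scar of the generator by homogeneity of
the final profile + mean value inequality in time with `‖∂ₜV‖, ‖x‖‖∂ₜ∇V‖ ≲ (‖x‖+√(−t))⁻³`; the core part is the
apex bound). [folklore] -/
theorem stub_dilationGeneratorFlat :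
    ∀ (V : ℝ → ℝ³ → ℝ³) (Q : ℝ → ℝ³ → ℝ) (C : ℝ), 0 < C →
      IsTypeIAncientMild C V → HasTypeIDecay C V → IsClassicalNSSolutionOn (Iio (0 : ℝ)) 1 0 V Q →
      ScaleInvariantBounds V Q → (∀ lam : ℝ, 0 < lam → SameScar (nsRescale lam V) V) →
      ∃ K : ℝ, ∀ t < 0, ∀ x : ℝ³,
        ‖V t x + fderiv ℝ (V t) x x‖ ≤ K * ((-t) / (‖x‖ + Real.sqrt (-t)) ^ 3) := by
  intro V Q C hC _ hdV hcl hB hhom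
  have hV : IsSmoothSpaceTimeOn (Iio (0 : ℝ)) V := hcl.smooth_velocity
  -- the package at orders `0` and `1`, in plain clothing
  obtain ⟨L₀, hL0⟩ := hB 0
  obtain ⟨L₁, hL1⟩ := hB 1
  have hL₀ : 0 ≤ L₀ := nonneg_of_timeDeriv_bound fun t ht x => (hL0 t ht x).2.2
  have hL₁ : 0 ≤ L₁ := nonneg_of_timeDeriv_bound fun t ht x => (hL1 t ht x).2.2
  have hT0 : ∀ t < 0, ∀ x : ℝ³, ‖deriv (fun s => V s x) t‖ ≤ L₀ / (‖x‖ + Real.sqrt (-t)) ^ 3 := by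
    intro t ht x
    have h := (hL0 t ht x).2.2
    rw [deriv_iteratedFDeriv_slice hV isOpen_Iio 0 ht x, norm_iteratedFDeriv_zero] at h
    simpa using h
  have hD1 : ∀ t < 0, ∀ x : ℝ³, ‖fderiv ℝ (V t) x‖ ≤ L₁ / (‖x‖ + Real.sqrt (-t)) ^ 2 := by
    intro t ht x
    have h := (hL1 t ht x).1
    rw [norm_iteratedFDeriv_one] at h
    simpa using h
  have hT1 : ∀ t < 0, ∀ x : ℝ³,
      ‖fderiv ℝ (fun y => deriv (fun s => V s y) t) x‖ ≤ L₁ / (‖x‖ + Real.sqrt (-t)) ^ 4 := by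
    intro t ht x
    have h := (hL1 t ht x).2.2
    rw [deriv_iteratedFDeriv_slice hV isOpen_Iio 1 ht x, norm_iteratedFDeriv_one] at h
    simpa using h
  -- the scar of the rescalings, pointwise
  have hscal : ∀ lam : ℝ, 0 < lam → ∀ x : ℝ³, x ≠ 0 →
      Tendsto (fun s => nsRescale lam V s x - V s x) (𝓝[<] (0 : ℝ)) (𝓝 0) := fun lam hlam x hx =>
    tendsto_sub_of_sameScar (isSmoothSpaceTimeOn_nsRescale hV hlam) hV (hhom lam hlam) hx
  -- Step 3: the far-field bound `‖g(t,x)‖ ≤ (L₀+L₁)(−t)/‖x‖³` off the origin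
  have hfar : ∀ t < 0, ∀ x : ℝ³, x ≠ 0 →
      ‖V t x + fderiv ℝ (V t) x x‖ ≤ (L₀ + L₁) / ‖x‖ ^ 3 * (-t) := by
    intro t ht x hx
    have hxpos : 0 < ‖x‖ := norm_pos_iff.2 hx
    have hderiv : ∀ s ∈ Iio (0 : ℝ), HasDerivWithinAt (fun s => V s x + fderiv ℝ (V s) x x)
        (deriv (fun s => V s x) s + fderiv ℝ (fun y => deriv (fun σ => V σ y) s) x x) (Iio 0) s :=
      fun s hs => ((hV.hasDerivAt_timeLine isOpen_Iio hs x).add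
        (hV.hasDerivAt_fderiv_slice isOpen_Iio hs x x)).hasDerivWithinAt
    have hbound : ∀ s ∈ Iio (0 : ℝ),
        ‖deriv (fun s => V s x) s + fderiv ℝ (fun y => deriv (fun σ => V σ y) s) x x‖ ≤
          (L₀ + L₁) / ‖x‖ ^ 3 := by
      intro s hs
      have hs' : s < 0 := hs
      have hρ : ‖x‖ ≤ ‖x‖ + Real.sqrt (-s) := le_add_of_nonneg_right (Real.sqrt_nonneg _)
      have hρ3 : ‖x‖ ^ 3 ≤ (‖x‖ + Real.sqrt (-s)) ^ 3 := pow_le_pow_left₀ (norm_nonneg _) hρ 3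
      have hρ4 : ‖x‖ ^ 4 ≤ (‖x‖ + Real.sqrt (-s)) ^ 4 := pow_le_pow_left₀ (norm_nonneg _) hρ 4
      have h0 : ‖deriv (fun s => V s x) s‖ ≤ L₀ / ‖x‖ ^ 3 :=
        (hT0 s hs' x).trans (div_le_div_of_nonneg_left hL₀ (pow_pos hxpos 3) hρ3)
      have h1 : ‖fderiv ℝ (fun y => deriv (fun σ => V σ y) s) x x‖ ≤ L₁ / ‖x‖ ^ 3 := by
        calc ‖fderiv ℝ (fun y => deriv (fun σ => V σ y) s) x x‖
            ≤ ‖fderiv ℝ (fun y => deriv (fun σ => V σ y) s) x‖ * ‖x‖ := ContinuousLinearMap.le_opNorm _ _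
          _ ≤ L₁ / ‖x‖ ^ 4 * ‖x‖ := mul_le_mul_of_nonneg_right
              ((hT1 s hs' x).trans (div_le_div_of_nonneg_left hL₁ (pow_pos hxpos 4) hρ4)) (norm_nonneg _)
          _ = L₁ / ‖x‖ ^ 3 := by
              rw [div_mul_eq_mul_div, div_eq_div_iff (pow_ne_zero 4 hxpos.ne') (pow_ne_zero 3 hxpos.ne')]
              ring
      calc _ ≤ ‖deriv (fun s => V s x) s‖ + ‖fderiv ℝ (fun y => deriv (fun σ => V σ y) s) x x‖ :=
            norm_add_le _ _
        _ ≤ L₀ / ‖x‖ ^ 3 + L₁ / ‖x‖ ^ 3 := add_le_add h0 h1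
        _ = (L₀ + L₁) / ‖x‖ ^ 3 := (add_div _ _ _).symm
    have hmv : ∀ s ∈ Iio (0 : ℝ),
        ‖(V s x + fderiv ℝ (V s) x x) - (V t x + fderiv ℝ (V t) x x)‖ ≤ (L₀ + L₁) / ‖x‖ ^ 3 * ‖s - t‖ :=
      fun s hs => (convex_Iio (0 : ℝ)).norm_image_sub_le_of_norm_hasDerivWithin_le hderiv hbound ht hs
    have hg0 := tendsto_dilationGenerator_zero hV hL₀ hL₁ hT0 hT1 hscal hx
    have hlhs : Tendsto (fun s => ‖(V s x + fderiv ℝ (V s) x x) - (V t x + fderiv ℝ (V t) x x)‖) (𝓝[<] 0)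
        (𝓝 ‖(0 : ℝ³) - (V t x + fderiv ℝ (V t) x x)‖) :=
      (hg0.sub_const _).norm
    have hrhs : Tendsto (fun s : ℝ => (L₀ + L₁) / ‖x‖ ^ 3 * ‖s - t‖) (𝓝[<] 0)
        (𝓝 ((L₀ + L₁) / ‖x‖ ^ 3 * ‖(0 : ℝ) - t‖)) :=
      ((tendsto_id.sub_const t).norm.const_mul _).mono_left nhdsWithin_le_nhds
    have hle := le_of_tendsto_of_tendsto hlhs hrhs (eventually_mem_nhdsWithin.mono hmv)
    simp only [zero_sub, norm_neg, Real.norm_eq_abs, abs_of_neg ht] at hle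
    exact hle
  -- Step 4: the weighted form
  refine ⟨8 * (L₀ + L₁) + 8 * (C + L₁), fun t ht x => ?_⟩
  have hnt : 0 < -t := by linarith
  have hσ : 0 < Real.sqrt (-t) := Real.sqrt_pos.2 hnt
  have hσ2 : Real.sqrt (-t) ^ 2 = -t := Real.sq_sqrt hnt.le
  set R : ℝ := ‖x‖ + Real.sqrt (-t) with hR
  have hR0 : 0 < R := add_pos_of_nonneg_of_pos (norm_nonneg _) hσ
  have hw0 : 0 ≤ (-t) / R ^ 3 := div_nonneg hnt.le (pow_nonneg hR0.le 3)
  have hK1 : 0 ≤ 8 * (L₀ + L₁) := by positivity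
  have hK2 : 0 ≤ 8 * (C + L₁) := by positivity
  rcases le_or_gt (Real.sqrt (-t)) ‖x‖ with hfarx | hcore
  · -- far field: `√(−t) ≤ ‖x‖`
    have hxpos : 0 < ‖x‖ := hσ.trans_le hfarx
    have hx : x ≠ 0 := norm_pos_iff.1 hxpos
    have hR2 : R ≤ 2 * ‖x‖ := by rw [hR]; linarith
    have hR3 : R ^ 3 ≤ 8 * ‖x‖ ^ 3 := by
      calc R ^ 3 ≤ (2 * ‖x‖) ^ 3 := pow_le_pow_left₀ hR0.le hR2 3
        _ = 8 * ‖x‖ ^ 3 := by ring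
    have hw : (-t) / ‖x‖ ^ 3 ≤ 8 * ((-t) / R ^ 3) := by
      rw [← mul_div_assoc, div_le_div_iff₀ (pow_pos hxpos 3) (pow_pos hR0 3)]
      nlinarith [mul_le_mul_of_nonneg_left hR3 hnt.le]
    calc ‖V t x + fderiv ℝ (V t) x x‖ ≤ (L₀ + L₁) / ‖x‖ ^ 3 * (-t) := hfar t ht x hx
      _ = (L₀ + L₁) * ((-t) / ‖x‖ ^ 3) := by ring
      _ ≤ (L₀ + L₁) * (8 * ((-t) / R ^ 3)) := mul_le_mul_of_nonneg_left hw (add_nonneg hL₀ hL₁)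
      _ = 8 * (L₀ + L₁) * ((-t) / R ^ 3) := by ring
      _ ≤ (8 * (L₀ + L₁) + 8 * (C + L₁)) * ((-t) / R ^ 3) := by nlinarith [mul_nonneg hK2 hw0]
  · -- core: `‖x‖ < √(−t)`
    have hR2 : R ≤ 2 * Real.sqrt (-t) := by rw [hR]; linarith
    have hR3 : R ^ 3 ≤ 8 * ((-t) * Real.sqrt (-t)) := by
      calc R ^ 3 ≤ (2 * Real.sqrt (-t)) ^ 3 := pow_le_pow_left₀ hR0.le hR2 3
        _ = 8 * (Real.sqrt (-t) ^ 2 * Real.sqrt (-t)) := by ring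
        _ = 8 * ((-t) * Real.sqrt (-t)) := by rw [hσ2]
    -- `1/R ≤ 1/√(−t) ≤ 8 (−t)/R³`
    have hinv : 1 / R ≤ 8 * ((-t) / R ^ 3) := by
      rw [← mul_div_assoc, div_le_div_iff₀ hR0 (pow_pos hR0 3)]
      have hRσ : Real.sqrt (-t) ≤ R := by rw [hR]; linarith [norm_nonneg x]
      nlinarith [mul_le_mul_of_nonneg_left hRσ (by positivity : (0 : ℝ) ≤ 8 * (-t)), hR3]
    have hV0 : ‖V t x‖ ≤ C / R := hdV t ht x
    have hV1 : ‖fderiv ℝ (V t) x x‖ ≤ L₁ / R := by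
      have hxR : ‖x‖ ≤ R := by rw [hR]; linarith [hσ.le]
      calc ‖fderiv ℝ (V t) x x‖ ≤ ‖fderiv ℝ (V t) x‖ * ‖x‖ := ContinuousLinearMap.le_opNorm _ _
        _ ≤ L₁ / R ^ 2 * R := mul_le_mul (hD1 t ht x) hxR (norm_nonneg _)
            (div_nonneg hL₁ (pow_nonneg hR0.le 2))
        _ = L₁ / R := by
            rw [div_mul_eq_mul_div, div_eq_div_iff (pow_ne_zero 2 hR0.ne') hR0.ne']
            ring
    calc ‖V t x + fderiv ℝ (V t) x x‖ ≤ ‖V t x‖ + ‖fderiv ℝ (V t) x x‖ := norm_add_le _ _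
      _ ≤ C / R + L₁ / R := add_le_add hV0 hV1
      _ = (C + L₁) * (1 / R) := by ring
      _ ≤ (C + L₁) * (8 * ((-t) / R ^ 3)) := mul_le_mul_of_nonneg_left hinv (by positivity)
      _ = 8 * (C + L₁) * ((-t) / R ^ 3) := by ring
      _ ≤ (8 * (L₀ + L₁) + 8 * (C + L₁)) * ((-t) / R ^ 3) := by nlinarith [mul_nonneg hK1 hw0]

end Summit.NavierStokesRegularity.NavierStokesRegularity.Theorems.RellichScarScarRigidity

end
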